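import Literature.Computability.AlgebraicComplexity.BI17TensorCorollaryBridges
import Literature.Computability.AlgebraicComplexity.MatMulOccurrenceObstructionsProofs
import Mathlib.RingTheory.Polynomial.RationalRoot
import Mathlib.RingTheory.Polynomial.UniqueFactorization
import Mathlib.Algebra.MvPolynomial.Funext
import HarnessLib

/-!
# Bürgisser–Ikenmeyer 2017, Thm. 4.2 for `m = 2`: the generic stabilizer period of `⊗³ℂ²` is
# `a(2) = 2` — PROOF

P. Bürgisser, C. Ikenmeyer, *Fundamental invariants of orbit closures*, J. Algebra **477** (2017)
390–434 = arXiv:1511.02927 [BurgisserIkenmeyer2017], §4.1, Thm. 4.2 (TeX `main.tex` L1612: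
"We have `a(m) = 1` for `m ≥ 3` and `a(2) = 2`"; proof L1616–1620: "If `m = 2` one can show that
`stab(w) ≃ stab(⟨2⟩)` for almost all `w ∈ (ℂ²)^{⊗3}`. Hence `a(2) = 2` by Theorem 4.3(2)"; held
text `paper:arxiv-1511.02927` p0015). THEOREMS ONLY; sibling of the statement file
`BI17FundamentalInvariantTensors.lean` (val-lit row BI2017-B, file of record t04), whose named fact
`BI2017_thm_4_2` is the conjunction of the `m ≥ 3` clause (A. M. Popov's classification, not
proved here) and the `m = 2` clause proved below as `BI2017_thm_4_2_two`; nothing is restated.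

Proof, following the printed hint: off an explicit hypersurface a tensor `w ∈ ⊗³ℂ²` lies in the
`GL₂³`-orbit of the unit tensor `⟨2⟩` (`exists_gl_actTensor_unitTensor_two_eq`, an explicit rank-two
decomposition `w = ∑_i u_i ⊗ v_i ⊗ z_i`: with slices `M₀ = w_{0··}`, `M₁ = w_{1··}`, `det M₀ ≠ 0`,
the matrix `N = M₁ adj(M₀)` has distinct eigenvalues as soon as Cayley's hyperdeterminant
`Det(w) = tr(N)² − 4 det(M₀)det(M₁)` is nonzero, and its eigenvectors give `v_i`), so
`a(w) = a(g·⟨2⟩) = a(⟨2⟩) = 2` by the orbit invariance of the period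
(`tensorStabilizerPeriod_actTensor`) and Thm. 4.3(2) (`BI2017_thm_4_3_holds`). The same dense-orbit
statement (`isZariskiGenericTensor_mem_tensorGLOrbit_unitTensor_two`) gives Prop. 4.10 for `m = 2`
(`BI2017_prop_4_10_two`: almost all `w ∈ ⊗³ℂ²` are polystable, by Cor. 4.9 for `⟨2⟩` and the orbit
invariance of polystability `IsPolystableTensor.actTensor_gl`), and the remark before Cor. 5.12
(L2224: "the orbit closure of almost all `w ∈ ⊗³ℂ²` equals `⊗³ℂ²` and hence is normal"):
`tensorOrbitVanishingIdeal_unitTensor_two` (`I(G·⟨2⟩) = 0`),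
`BI2017_generic_tensorOrbitVanishingIdeal_eq_bot_two`, `BI2017_generic_orbitClosure_normal_two`
(`ℂ[⊗³ℂ²]` is a UFD, hence integrally closed).

Honest framing: typed-literature proofs for the cell `val-lit`; nothing here bears on VP versus VNP.

## References

* [BurgisserIkenmeyer2017] P. Bürgisser, C. Ikenmeyer, *Fundamental invariants of orbit closures*,
  J. Algebra 477 (2017) 390–434; arXiv:1511.02927, Thm. 4.2, Thm. 4.3.
* I. M. Gelfand, M. M. Kapranov, A. V. Zelevinsky, *Discriminants, resultants, and multidimensional
  determinants*, Birkhäuser 1994, Ch. 14 §1 (the `2 × 2 × 2` hyperdeterminant and the dense orbit).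
-/

noncomputable section

open MvPolynomial Matrix

namespace Literature.Computability.AlgebraicComplexity

section GenericPeriodTwo

/-- `∑_i x_i S_{bi} Z_{ci} = (S · diag(x) · Zᵀ)_{bc}`. [folklore] -/
private theorem sum_mul_mul_eq_mul_diagonal_mul_transpose_apply (S Z : Matrix (Fin 2) (Fin 2) ℂ)
    (x : Fin 2 → ℂ) (b c : Fin 2) :
    ∑ i, x i * S b i * Z c i = (S * diagonal x * Zᵀ) b c := by
  rw [Matrix.mul_apply]
  simp only [Matrix.mul_diagonal, Matrix.transpose_apply, Fin.sum_univ_two]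
  ring

/-- **Normal form of `2 × 2 × 2` tensors** (the dense `GL₂³`-orbit of `⟨2⟩`): if the slice
`M₀ = w_{0··}` is invertible, the entry `N₀₁` of `N = M₁ adj(M₀)` is nonzero and the
hyperdeterminant `Det(w) ≠ 0`, then `w = (T ⊗ S ⊗ Z)·⟨2⟩` for explicit invertible `T, S, Z`
(columns: `(1, μ_i/det M₀)`, the eigenvectors `(N₀₁, μ_i − N₀₀)` of `N`, and `Z = (S⁻¹M₀)ᵀ`,
`μ_± = (tr N ± √Det)/2`). [cite: BurgisserIkenmeyer2017, Thm. 4.2 (proof, case `m = 2`)] -/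
theorem exists_gl_actTensor_unitTensor_two_eq (w : Fin 2 → Fin 2 → Fin 2 → ℂ)
    (h0 : w 0 0 0 * w 0 1 1 - w 0 0 1 * w 0 1 0 ≠ 0)
    (h1 : w 1 0 1 * w 0 0 0 - w 1 0 0 * w 0 0 1 ≠ 0)
    (h2 : (w 0 0 0 * w 1 1 1 - w 0 0 1 * w 1 1 0 - w 0 1 0 * w 1 0 1 + w 0 1 1 * w 1 0 0) ^ 2 -
        4 * ((w 0 0 0 * w 0 1 1 - w 0 0 1 * w 0 1 0) *
          (w 1 0 0 * w 1 1 1 - w 1 0 1 * w 1 1 0)) ≠ 0) :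
    ∃ g : GL (Fin 2) ℂ × GL (Fin 2) ℂ × GL (Fin 2) ℂ,
      actTensor (g.1 : Matrix (Fin 2) (Fin 2) ℂ) (g.2.1 : Matrix (Fin 2) (Fin 2) ℂ)
        (g.2.2 : Matrix (Fin 2) (Fin 2) ℂ) (unitTensor ℂ 2) = w := by
  -- the slices `M₀ = w_{0··}`, `M₁ = w_{1··}` and `N = M₁ adj(M₀)`
  obtain ⟨M₀, hM₀⟩ : ∃ M : Matrix (Fin 2) (Fin 2) ℂ, M = Matrix.of fun b c => w 0 b c := ⟨_, rfl⟩
  obtain ⟨M₁, hM₁⟩ : ∃ M : Matrix (Fin 2) (Fin 2) ℂ, M = Matrix.of fun b c => w 1 b c := ⟨_, rfl⟩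
  have hdet₀ : M₀.det = w 0 0 0 * w 0 1 1 - w 0 0 1 * w 0 1 0 := by
    rw [Matrix.det_fin_two, hM₀]; rfl
  have hP0 : M₀.det ≠ 0 := by rw [hdet₀]; exact h0
  obtain ⟨N, hN⟩ : ∃ M : Matrix (Fin 2) (Fin 2) ℂ, M = M₁ * M₀.adjugate := ⟨_, rfl⟩
  have hN00 : N 0 0 = w 1 0 0 * w 0 1 1 - w 1 0 1 * w 0 1 0 := by
    simp [hN, Matrix.mul_apply, Matrix.adjugate_fin_two, Fin.sum_univ_two, hM₀, hM₁]; ring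
  have hN01 : N 0 1 = w 1 0 1 * w 0 0 0 - w 1 0 0 * w 0 0 1 := by
    simp [hN, Matrix.mul_apply, Matrix.adjugate_fin_two, Fin.sum_univ_two, hM₀, hM₁]; ring
  have hN10 : N 1 0 = w 1 1 0 * w 0 1 1 - w 1 1 1 * w 0 1 0 := by
    simp [hN, Matrix.mul_apply, Matrix.adjugate_fin_two, Fin.sum_univ_two, hM₀, hM₁]; ring
  have hN11 : N 1 1 = w 1 1 1 * w 0 0 0 - w 1 1 0 * w 0 0 1 := by
    simp [hN, Matrix.mul_apply, Matrix.adjugate_fin_two, Fin.sum_univ_two, hM₀, hM₁]; ring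
  have hN01ne : N 0 1 ≠ 0 := by rw [hN01]; exact h1
  -- the discriminant of the characteristic polynomial of `N` is the hyperdeterminant
  have hdisc : (N 0 0 + N 1 1) ^ 2 - 4 * (N 0 0 * N 1 1 - N 0 1 * N 1 0) =
      (w 0 0 0 * w 1 1 1 - w 0 0 1 * w 1 1 0 - w 0 1 0 * w 1 0 1 + w 0 1 1 * w 1 0 0) ^ 2 -
        4 * ((w 0 0 0 * w 0 1 1 - w 0 0 1 * w 0 1 0) *
          (w 1 0 0 * w 1 1 1 - w 1 0 1 * w 1 1 0)) := by
    rw [hN00, hN01, hN10, hN11]; ring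
  obtain ⟨s, hs⟩ := IsAlgClosed.exists_pow_nat_eq
    ((N 0 0 + N 1 1) ^ 2 - 4 * (N 0 0 * N 1 1 - N 0 1 * N 1 0)) two_pos
  have hs0 : s ≠ 0 := by
    rintro rfl
    apply h2
    rw [← hdisc, ← hs]
    norm_num
  -- the two eigenvalues `μ_± = (tr N ± s)/2`
  obtain ⟨μp, hμp⟩ : ∃ x : ℂ, x = (N 0 0 + N 1 1 + s) / 2 := ⟨_, rfl⟩
  obtain ⟨μm, hμm⟩ : ∃ x : ℂ, x = (N 0 0 + N 1 1 - s) / 2 := ⟨_, rfl⟩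
  have hchar_p : μp ^ 2 - (N 0 0 + N 1 1) * μp + (N 0 0 * N 1 1 - N 0 1 * N 1 0) = 0 := by
    rw [hμp]; linear_combination (1 / 4 : ℂ) * hs
  have hchar_m : μm ^ 2 - (N 0 0 + N 1 1) * μm + (N 0 0 * N 1 1 - N 0 1 * N 1 0) = 0 := by
    rw [hμm]; linear_combination (1 / 4 : ℂ) * hs
  have hμ : μm - μp = -s := by rw [hμp, hμm]; ring
  -- the eigenvector matrix `S` and `N S = S diag(μ_+, μ_-)`
  obtain ⟨S, hS⟩ : ∃ M : Matrix (Fin 2) (Fin 2) ℂ,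
      M = !![N 0 1, N 0 1; μp - N 0 0, μm - N 0 0] := ⟨_, rfl⟩
  have hSdet : S.det = -(N 0 1 * s) := by
    rw [Matrix.det_fin_two, hS]; simp; linear_combination N 0 1 * hμ
  have hSdet0 : S.det ≠ 0 := by rw [hSdet]; exact neg_ne_zero.2 (mul_ne_zero hN01ne hs0)
  have hSunit : IsUnit S.det := isUnit_iff_ne_zero.2 hSdet0
  have hNS : N * S = S * diagonal ![μp, μm] := by
    ext i j
    fin_cases i <;> fin_cases j
    · simp [Matrix.mul_apply, Fin.sum_univ_two, hS]; ring
    · simp [Matrix.mul_apply, Fin.sum_univ_two, hS]; ring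
    · simp [Matrix.mul_apply, Fin.sum_univ_two, hS]; linear_combination (-1 : ℂ) * hchar_p
    · simp [Matrix.mul_apply, Fin.sum_univ_two, hS]; linear_combination (-1 : ℂ) * hchar_m
  -- the first-factor matrix `T` (rows `e_0 ↦ (1,1)`, `e_1 ↦ (μ_+, μ_-)/det M₀`) and `Z = (S⁻¹ M₀)ᵀ`
  obtain ⟨T, hT⟩ : ∃ M : Matrix (Fin 2) (Fin 2) ℂ,
      M = !![1, 1; μp / M₀.det, μm / M₀.det] := ⟨_, rfl⟩
  have hTdet : T.det = -s / M₀.det := by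
    rw [Matrix.det_fin_two, hT]; simp; rw [← hμ]; ring
  have hTdet0 : T.det ≠ 0 := by rw [hTdet]; exact div_ne_zero (neg_ne_zero.2 hs0) hP0
  obtain ⟨Z, hZ⟩ : ∃ M : Matrix (Fin 2) (Fin 2) ℂ, M = (S⁻¹ * M₀)ᵀ := ⟨_, rfl⟩
  have hZdet0 : Z.det ≠ 0 := by
    rw [hZ, Matrix.det_transpose, Matrix.det_mul, Matrix.det_nonsing_inv, Ring.inverse_eq_inv']
    exact mul_ne_zero (inv_ne_zero hSdet0) hP0
  -- the two slice identities `S Zᵀ = M₀` and `S diag(μ/det M₀) Zᵀ = M₁`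
  have hslice₀ : S * diagonal (T 0) * Zᵀ = M₀ := by
    have hT0 : T 0 = fun _ => (1 : ℂ) := by
      funext i; fin_cases i <;> simp [hT]
    rw [hT0, diagonal_one, Matrix.mul_one, hZ, Matrix.transpose_transpose]
    exact Matrix.mul_nonsing_inv_cancel_left S M₀ hSunit
  have hslice₁ : S * diagonal (T 1) * Zᵀ = M₁ := by
    have hT1 : T 1 = (M₀.det)⁻¹ • (![μp, μm] : Fin 2 → ℂ) := by
      funext i; fin_cases i <;> simp [hT, div_eq_inv_mul]
    rw [hT1, diagonal_smul, Matrix.mul_smul, Matrix.smul_mul, ← hNS, hZ,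
      Matrix.transpose_transpose, Matrix.mul_assoc N S, Matrix.mul_nonsing_inv_cancel_left S M₀ hSunit,
      hN, Matrix.mul_assoc, Matrix.adjugate_mul, Matrix.mul_smul, Matrix.mul_one, smul_smul,
      inv_mul_cancel₀ hP0, one_smul]
  -- assemble
  refine ⟨(Matrix.GeneralLinearGroup.mkOfDetNeZero T hTdet0,
    Matrix.GeneralLinearGroup.mkOfDetNeZero S hSdet0,
    Matrix.GeneralLinearGroup.mkOfDetNeZero Z hZdet0), ?_⟩
  funext a b c
  simp only [Matrix.GeneralLinearGroup.val_mkOfDetNeZero]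
  rw [actTensor_unitTensor_apply]
  rw [show (∑ i, T a i * S b i * Z c i) = ∑ i, (T a) i * S b i * Z c i from rfl,
    sum_mul_mul_eq_mul_diagonal_mul_transpose_apply]
  fin_cases a
  · simp only [Fin.zero_eta, Fin.isValue]
    rw [hslice₀, hM₀, Matrix.of_apply]
  · simp only [Fin.mk_one, Fin.isValue]
    rw [hslice₁, hM₁, Matrix.of_apply]

/-- Genericity is monotone in the property. [cite: BurgisserIkenmeyer2017, §4.1 ("almost all")] -/
theorem IsZariskiGenericTensor.mono {ι k : Type*} [Fintype ι] [DecidableEq ι] [Field k]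
    {P Q : (ι → ι → ι → k) → Prop} (hPQ : ∀ w, P w → Q w) (hP : IsZariskiGenericTensor P) :
    IsZariskiGenericTensor Q := by
  obtain ⟨F, hF, h⟩ := hP
  exact ⟨F, hF, fun w hw => hPQ w (h w hw)⟩

/-- **Almost all `w ∈ ⊗³ℂ²` lie in the `GL₂³`-orbit of the unit tensor `⟨2⟩`** (the orbit of `⟨2⟩`
is dense: off the zero set of the nonzero polynomial `det(w_{0··}) · N₀₁ · Det`).
[cite: BurgisserIkenmeyer2017, Thm. 4.2 (proof, case `m = 2`)] -/
theorem isZariskiGenericTensor_mem_tensorGLOrbit_unitTensor_two :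
    IsZariskiGenericTensor fun w : Fin 2 → Fin 2 → Fin 2 → ℂ => w ∈ tensorGLOrbit (unitTensor ℂ 2) := by
  let P₀ : MvPolynomial (Fin 2 × Fin 2 × Fin 2) ℂ := X (0, 0, 0) * X (0, 1, 1) - X (0, 0, 1) * X (0, 1, 0)
  let P₁ : MvPolynomial (Fin 2 × Fin 2 × Fin 2) ℂ := X (1, 0, 1) * X (0, 0, 0) - X (1, 0, 0) * X (0, 0, 1)
  let P₂ : MvPolynomial (Fin 2 × Fin 2 × Fin 2) ℂ :=
    (X (0, 0, 0) * X (1, 1, 1) - X (0, 0, 1) * X (1, 1, 0) - X (0, 1, 0) * X (1, 0, 1) +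
        X (0, 1, 1) * X (1, 0, 0)) ^ 2 -
      4 * ((X (0, 0, 0) * X (0, 1, 1) - X (0, 0, 1) * X (0, 1, 0)) *
        (X (1, 0, 0) * X (1, 1, 1) - X (1, 0, 1) * X (1, 1, 0)))
  have hev : ∀ w : Fin 2 → Fin 2 → Fin 2 → ℂ, aeval (tensorPt w) (P₀ * P₁ * P₂) =
      (w 0 0 0 * w 0 1 1 - w 0 0 1 * w 0 1 0) * (w 1 0 1 * w 0 0 0 - w 1 0 0 * w 0 0 1) *
        ((w 0 0 0 * w 1 1 1 - w 0 0 1 * w 1 1 0 - w 0 1 0 * w 1 0 1 + w 0 1 1 * w 1 0 0) ^ 2 -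
          4 * ((w 0 0 0 * w 0 1 1 - w 0 0 1 * w 0 1 0) *
            (w 1 0 0 * w 1 1 1 - w 1 0 1 * w 1 1 0))) := by
    intro w
    simp only [P₀, P₁, P₂, map_mul, map_sub, map_add, map_pow, aeval_X, tensorPt, map_ofNat]
  refine ⟨P₀ * P₁ * P₂, fun h => ?_, fun w hw => ?_⟩
  · -- nonzero: evaluate at `M₀ = 1`, `M₁ = (0 1; 1 1)`
    have h' := hev fun a b c => if a = 0 then (if b = c then 1 else 0) else (if b = 0 ∧ c = 0 then 0 else 1)
    rw [h, map_zero] at h'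
    norm_num at h'
  · rw [hev] at hw
    obtain ⟨g, hg⟩ := exists_gl_actTensor_unitTensor_two_eq w
      (left_ne_zero_of_mul (left_ne_zero_of_mul hw)) (right_ne_zero_of_mul (left_ne_zero_of_mul hw))
      (right_ne_zero_of_mul hw)
    exact ⟨g, hg.symm⟩

/-- **BI 2017, Thm. 4.2, case `m = 2`: `a(2) = 2`** — almost all `w ∈ ⊗³ℂ²` have stabilizer period
`2`: almost all `w` lie in `GL₂³·⟨2⟩`, the period is an orbit invariant
(`tensorStabilizerPeriod_actTensor`) and `a(⟨2⟩) = 2` (Thm. 4.3(2), `BI2017_thm_4_3_holds`).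
[cite: BurgisserIkenmeyer2017, Thm. 4.2] -/
theorem BI2017_thm_4_2_two :
    IsZariskiGenericTensor fun w : Fin 2 → Fin 2 → Fin 2 → ℂ => tensorStabilizerPeriod w = 2 := by
  refine isZariskiGenericTensor_mem_tensorGLOrbit_unitTensor_two.mono fun w hw => ?_
  obtain ⟨g, rfl⟩ := hw
  rw [tensorStabilizerPeriod_actTensor]
  exact (BI2017_thm_4_3_holds 2).2 (by norm_num)

/-- **BI 2017, Prop. 4.10, case `m = 2`**: almost all `w ∈ ⊗³ℂ²` are polystable (they lie in the
`GL₂³`-orbit of `⟨2⟩`, which is polystable by Cor. 4.9, and polystability is a property of orbits).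
[cite: BurgisserIkenmeyer2017, Prop. 4.10] -/
theorem BI2017_prop_4_10_two :
    IsZariskiGenericTensor (IsPolystableTensor : (Fin 2 → Fin 2 → Fin 2 → ℂ) → Prop) := by
  refine isZariskiGenericTensor_mem_tensorGLOrbit_unitTensor_two.mono fun w hw => ?_
  obtain ⟨g, rfl⟩ := hw
  exact (BI2017_cor_4_9_unitTensor_holds 2).actTensor_gl g

end GenericPeriodTwo

/-! ### "The orbit closure of almost all `w ∈ ⊗³ℂ²` equals `⊗³ℂ²` and hence is normal" -/

section GenericNormalTwo

variable {ι : Type*} [Fintype ι] [DecidableEq ι]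

/-- Points of one `GL³`-orbit have the same orbit. [cite: BurgisserIkenmeyer2017, §5 (the orbit `Gw`)] -/
theorem tensorGLOrbit_eq_of_mem {u w : ι → ι → ι → ℂ} (hw : w ∈ tensorGLOrbit u) :
    tensorGLOrbit w = tensorGLOrbit u := by
  obtain ⟨g, rfl⟩ := hw
  ext v
  simp only [tensorGLOrbit, Set.mem_setOf_eq]
  constructor
  · rintro ⟨h, rfl⟩
    refine ⟨h * g, ?_⟩
    simp only [Prod.fst_mul, Prod.snd_mul, Units.val_mul, actTensor_actTensor]
  · rintro ⟨h, rfl⟩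
    refine ⟨h * g⁻¹, ?_⟩
    simp only [Prod.fst_mul, Prod.snd_mul, Prod.fst_inv, Prod.snd_inv, Units.val_mul,
      actTensor_actTensor, Matrix.mul_assoc, Units.inv_mul, Matrix.mul_one]

/-- `I(G·w) = I(G·u)` for `w ∈ G·u`. [cite: BurgisserIkenmeyer2017, §5 (the coordinate ring `O(\overline{Gw})`)] -/
theorem tensorOrbitVanishingIdeal_eq_of_mem {u w : ι → ι → ι → ℂ} (hw : w ∈ tensorGLOrbit u) :
    tensorOrbitVanishingIdeal w = tensorOrbitVanishingIdeal u := by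
  rw [tensorOrbitVanishingIdeal, tensorOrbitVanishingIdeal, tensorGLOrbit_eq_of_mem hw]

/-- If almost all tensors lie in the orbit `G·u`, then `\overline{G·u} = ⊗³` scheme-theoretically:
`I(G·u) = 0` (a polynomial vanishing off a hypersurface vanishes identically, `ℂ` being infinite).
[cite: BurgisserIkenmeyer2017, §5.1 (before Cor. 5.12)] -/
theorem tensorOrbitVanishingIdeal_eq_bot_of_generic_mem {u : ι → ι → ι → ℂ}
    (h : IsZariskiGenericTensor fun w : ι → ι → ι → ℂ => w ∈ tensorGLOrbit u) :
    tensorOrbitVanishingIdeal u = ⊥ := by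
  obtain ⟨F, hF, hgen⟩ := h
  refine (Submodule.eq_bot_iff _).2 fun P hP => ?_
  rw [tensorOrbitVanishingIdeal, MvPolynomial.mem_vanishingIdeal_iff] at hP
  have hPF : P * F = 0 := by
    apply MvPolynomial.funext
    intro x
    rw [map_mul, map_zero]
    by_cases hx : MvPolynomial.eval x F = 0
    · rw [hx, mul_zero]
    · have hxt : tensorPt (fun a b c => x (a, b, c)) = x := funext fun _ => rfl
      have hmem : (fun a b c => x (a, b, c)) ∈ tensorGLOrbit u :=
        hgen (fun a b c => x (a, b, c)) (by rw [hxt]; simpa only [MvPolynomial.aeval_eq_eval] using hx)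
      have h0 := hP x ⟨_, hmem, hxt⟩
      simp only [MvPolynomial.aeval_eq_eval] at h0
      rw [h0, zero_mul]
  exact (mul_eq_zero.1 hPF).resolve_right hF

/-- **`\overline{GL₂³·⟨2⟩} = ⊗³ℂ²`**: the vanishing ideal of the orbit of the unit tensor `⟨2⟩` is
zero. [cite: BurgisserIkenmeyer2017, §5.1 (before Cor. 5.12)] -/
theorem tensorOrbitVanishingIdeal_unitTensor_two : tensorOrbitVanishingIdeal (unitTensor ℂ 2) = ⊥ :=
  tensorOrbitVanishingIdeal_eq_bot_of_generic_mem
    isZariskiGenericTensor_mem_tensorGLOrbit_unitTensor_two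

/-- **BI 2017, §5.1 (the remark before Cor. 5.12)**: "the orbit closure of almost all `w ∈ ⊗³ℂ²`
equals `⊗³ℂ²`" — `I(G·w) = 0` for almost all `w`. [cite: BurgisserIkenmeyer2017, §5.1 (before Cor. 5.12)] -/
theorem BI2017_generic_tensorOrbitVanishingIdeal_eq_bot_two :
    IsZariskiGenericTensor fun w : Fin 2 → Fin 2 → Fin 2 → ℂ => tensorOrbitVanishingIdeal w = ⊥ := by
  refine isZariskiGenericTensor_mem_tensorGLOrbit_unitTensor_two.mono fun w hw => ?_
  rw [tensorOrbitVanishingIdeal_eq_of_mem hw, tensorOrbitVanishingIdeal_unitTensor_two]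

/-- **BI 2017, §5.1 (the remark before Cor. 5.12)**: "… and hence is normal" — for almost all
`w ∈ ⊗³ℂ²` the coordinate ring `O(\overline{Gw}) = ℂ[⊗³ℂ²]` is integrally closed (a polynomial
ring, i.e. a UFD); contrast Cor. 5.12(2) (`m ≥ 3`: almost never normal).
[cite: BurgisserIkenmeyer2017, §5.1 (before Cor. 5.12)] -/
theorem BI2017_generic_orbitClosure_normal_two :
    IsZariskiGenericTensor fun w : Fin 2 → Fin 2 → Fin 2 → ℂ =>
      IsIntegrallyClosed (TensorOrbitCoordRing w) := by
  refine BI2017_generic_tensorOrbitVanishingIdeal_eq_bot_two.mono fun w hw => ?_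
  have f : MvPolynomial (Fin 2 × Fin 2 × Fin 2) ℂ ≃+* TensorOrbitCoordRing w :=
    (RingEquiv.quotientBot _).symm.trans (Ideal.quotEquivOfEq hw.symm)
  exact IsIntegrallyClosed.of_equiv f

/-- **The orbit closure `\overline{GL₂³·⟨2⟩} = ⊗³ℂ²` of the unit tensor `⟨2⟩` is normal** (its
coordinate ring is the polynomial ring `ℂ[⊗³ℂ²]`); contrast Cor. 5.26 (`⟨m⟩`, `m ≥ 5`: not normal).
[cite: BurgisserIkenmeyer2017, §5.1 (before Cor. 5.12)] -/
theorem isIntegrallyClosed_tensorOrbitCoordRing_unitTensor_two :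
    IsIntegrallyClosed (TensorOrbitCoordRing (unitTensor ℂ 2)) := by
  have f : MvPolynomial (Fin 2 × Fin 2 × Fin 2) ℂ ≃+* TensorOrbitCoordRing (unitTensor ℂ 2) :=
    (RingEquiv.quotientBot _).symm.trans (Ideal.quotEquivOfEq tensorOrbitVanishingIdeal_unitTensor_two.symm)
  exact IsIntegrallyClosed.of_equiv f

end GenericNormalTwo

end Literature.Computability.AlgebraicComplexity
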